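import Mathlib.Algebra.Polynomial.Derivative
import Mathlib.Tactic.LinearCombination
import Literature.NumberTheory.EllipticCurves.ModFiveCongruenceHessePolynomials

/-!
# stub_switch · k3 · GENERATION 15 — the extreme fibre `j = 1728` (`c₆ = 0`): a FIRST-ORDER anchor

Helper lemmas (all PROVED here, generic commutative ring `R`, polynomials `R[X]`) that remove the
hypothesis `c₆ ≠ 0` from g13's `kC6_seg_eq_C6` (the ONLY place F1♮ ⊊ F1 is used):

* Klein side: `kC6a/kC6b = ∂kC6`, Euler `a·kC6a + b·kC6b = 30·kC6`, Jacobi `kDa·kC6b − kDb·kC6a = 30·kC4²`,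
  `(kC6 ∘ linear path)'(0)`, hence `p'(0) = 30((l−1)·kC6 v + m·kC4 v²)`.
* Hesse side: values and path-derivatives at `t = 0` of Fisher's nine partials along
  `L = 1 − X + X·l`, `M = X·m`, hence `(C6N ∘ path)'(0) = 125452800·((l−1)c₆ + m c₄²)` (`= 30·4181760·(…)`),
  and `C6N(c₄,c₆,L,0) = 4181760·c₆·L³⁰`.
* `sign_rigidity_taylor1`: `p = ±q`, equal 0-th and 1-st Taylor coefficients at `0`, and
  (`q(0) ≠ 0 ∨ q'(0) ≠ 0 ∨ q = 0`) ⇒ `p = q`.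
Constants certified by exact rational arithmetic (py/j1728.py) before typing.
-/

open Polynomial
open Literature.NumberTheory.EllipticCurves.HesseFamilyFive

namespace Summit.ABC.ABC.Cruxes.FreyModularity.StubSwitchK3g15

section Klein
variable {R : Type*} [CommRing R]

/-- Klein's icosahedral forms (verbatim g9–g14). -/
def kD (a b : R) : R := a ^ 11 * b - 11 * a ^ 6 * b ^ 6 - a * b ^ 11
def kDa (a b : R) : R := 11 * a ^ 10 * b - 66 * a ^ 5 * b ^ 6 - b ^ 11
def kDb (a b : R) : R := a ^ 11 - 66 * a ^ 6 * b ^ 5 - 11 * a * b ^ 10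
def kC4 (a b : R) : R :=
  a ^ 20 + 228 * a ^ 15 * b ^ 5 + 494 * a ^ 10 * b ^ 10 - 228 * a ^ 5 * b ^ 15 + b ^ 20
def kC6 (a b : R) : R :=
  -a ^ 30 + 522 * a ^ 25 * b ^ 5 + 10005 * a ^ 20 * b ^ 10 + 10005 * a ^ 10 * b ^ 20
    - 522 * a ^ 5 * b ^ 25 - b ^ 30
def Mv1 (a b l m : R) : R := l * a - m * kDb a b
def Mv2 (a b l m : R) : R := l * b + m * kDa a b

/-- NEW (g15): the partials of Klein's `c₆`-form `T = kC6`. -/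
def kC6a (a b : R) : R :=
  -30 * a ^ 29 + 13050 * a ^ 24 * b ^ 5 + 200100 * a ^ 19 * b ^ 10 + 100050 * a ^ 9 * b ^ 20
    - 2610 * a ^ 4 * b ^ 25
def kC6b (a b : R) : R :=
  2610 * a ^ 25 * b ^ 4 + 100050 * a ^ 20 * b ^ 9 + 200100 * a ^ 10 * b ^ 19 - 13050 * a ^ 5 * b ^ 24
    - 30 * b ^ 29

/-- Euler for `kC6` (degree 30). -/
theorem klein_euler_C6 (a b : R) : a * kC6a a b + b * kC6b a b = 30 * kC6 a b := by
  simp only [kC6, kC6a, kC6b]; ring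

set_option maxHeartbeats 4000000 in
/-- **Klein's Jacobian identity `∂(f, T)/∂(a, b) = 30·H²`** (`f = kD`, `T = kC6`, `H = kC4`; degree 40). -/
theorem klein_jacobi_C6 (a b : R) : kDa a b * kC6b a b - kDb a b * kC6a a b = 30 * kC4 a b ^ 2 := by
  simp only [kDa, kDb, kC4, kC6a, kC6b]; ring

set_option maxHeartbeats 4000000 in
/-- The linear Taylor coefficient of `kC6` along a line: `(kC6(a + X d₁, b + X d₂))'(0) = d₁ kC6a + d₂ kC6b`. -/
theorem derivative_kC6_linear_eval_zero (a b d₁ d₂ : R) :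
    (derivative (kC6 (C a + X * C d₁) (C b + X * C d₂))).eval 0 = d₁ * kC6a a b + d₂ * kC6b a b := by
  simp only [kC6, kC6a, kC6b, derivative_add, derivative_sub, derivative_neg, derivative_mul,
    derivative_pow, derivative_C, derivative_X, derivative_ofNat, eval_add, eval_sub, eval_neg,
    eval_mul, eval_pow, eval_C, eval_X, eval_ofNat, eval_natCast, eval_one, eval_zero, Nat.cast_ofNat]
  ring

/-- **`p'(0)` on Fisher's segment** `v → M_v(l, m)`: `30·((l − 1)·kC6 v + m·kC4 v²)`. -/
theorem kC6_path_deriv (a b l m : R) :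
    (derivative (kC6 (C a + X * C (Mv1 a b l m - a)) (C b + X * C (Mv2 a b l m - b)))).eval 0 =
      30 * ((l - 1) * kC6 a b + m * kC4 a b ^ 2) := by
  rw [derivative_kC6_linear_eval_zero]
  have h1 := klein_euler_C6 a b
  have h2 := klein_jacobi_C6 a b
  simp only [Mv1, Mv2]
  linear_combination (l - 1) * h1 + m * h2

end Klein

section Hesse
variable {R : Type*} [CommRing R]

/-- The numerator of Fisher's `𝔠₆` (verbatim g13 `C6N`; `𝔠₆ = C6N / 4181760`). -/
def C6N (c₄ c₆ l m : R) : R :=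
  Dl c₄ c₆ l m * (-(Dllm c₄ c₆ l m * Dmm c₄ c₆ l m + Dll c₄ c₆ l m * Dmmm c₄ c₆ l m
      - 2 * Dlm c₄ c₆ l m * Dlmm c₄ c₆ l m))
    - Dm c₄ c₆ l m * (-(Dlll c₄ c₆ l m * Dmm c₄ c₆ l m + Dll c₄ c₆ l m * Dlmm c₄ c₆ l m
      - 2 * Dlm c₄ c₆ l m * Dllm c₄ c₆ l m))

/-! ### values at `t = 0` of the nine partials along `L = 1 − X + X·l`, `M = X·m` -/

theorem Dl_path_eval (c₄ c₆ l m : R) :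
    (Dl (C c₄) (C c₆) (1 - X + X * C l) (X * C m)).eval 0 = 12 := by
  simp only [Dl, eval_add, eval_sub, eval_neg, eval_mul, eval_pow, eval_C, eval_X, eval_ofNat, eval_one]
  ring
theorem Dm_path_eval (c₄ c₆ l m : R) :
    (Dm (C c₄) (C c₆) (1 - X + X * C l) (X * C m)).eval 0 = 0 := by
  simp only [Dm, eval_add, eval_sub, eval_neg, eval_mul, eval_pow, eval_C, eval_X, eval_ofNat, eval_one]
  ring
theorem Dll_path_eval (c₄ c₆ l m : R) :
    (Dll (C c₄) (C c₆) (1 - X + X * C l) (X * C m)).eval 0 = 132 := by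
  simp only [Dll, eval_add, eval_sub, eval_neg, eval_mul, eval_pow, eval_C, eval_X, eval_ofNat, eval_one]
  ring
theorem Dlm_path_eval (c₄ c₆ l m : R) :
    (Dlm (C c₄) (C c₆) (1 - X + X * C l) (X * C m)).eval 0 = 0 := by
  simp only [Dlm, eval_add, eval_sub, eval_neg, eval_mul, eval_pow, eval_C, eval_X, eval_ofNat, eval_one]
  ring
theorem Dmm_path_eval (c₄ c₆ l m : R) :
    (Dmm (C c₄) (C c₆) (1 - X + X * C l) (X * C m)).eval 0 = -132 * c₄ := by
  simp only [Dmm, eval_add, eval_sub, eval_neg, eval_mul, eval_pow, eval_C, eval_X, eval_ofNat, eval_one]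
  ring
theorem Dlll_path_eval (c₄ c₆ l m : R) :
    (Dlll (C c₄) (C c₆) (1 - X + X * C l) (X * C m)).eval 0 = 1320 := by
  simp only [Dlll, eval_add, eval_sub, eval_neg, eval_mul, eval_pow, eval_C, eval_X, eval_ofNat, eval_one]
  ring
theorem Dllm_path_eval (c₄ c₆ l m : R) :
    (Dllm (C c₄) (C c₆) (1 - X + X * C l) (X * C m)).eval 0 = 0 := by
  simp only [Dllm, eval_add, eval_sub, eval_neg, eval_mul, eval_pow, eval_C, eval_X, eval_ofNat, eval_one]
  ring
theorem Dlmm_path_eval (c₄ c₆ l m : R) :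
    (Dlmm (C c₄) (C c₆) (1 - X + X * C l) (X * C m)).eval 0 = -1320 * c₄ := by
  simp only [Dlmm, eval_add, eval_sub, eval_neg, eval_mul, eval_pow, eval_C, eval_X, eval_ofNat, eval_one]
  ring
theorem Dmmm_path_eval (c₄ c₆ l m : R) :
    (Dmmm (C c₄) (C c₆) (1 - X + X * C l) (X * C m)).eval 0 = -2640 * c₆ := by
  simp only [Dmmm, eval_add, eval_sub, eval_neg, eval_mul, eval_pow, eval_C, eval_X, eval_ofNat, eval_one]
  ring

/-! ### first derivatives at `t = 0` (path derivative `δF = (l−1)·F_λ(1,0) + m·F_μ(1,0)`) -/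

theorem Dl_path_deriv (c₄ c₆ l m : R) :
    (derivative (Dl (C c₄) (C c₆) (1 - X + X * C l) (X * C m))).eval 0 = 132 * (l - 1) := by
  simp only [Dl, derivative_add, derivative_sub, derivative_neg, derivative_mul, derivative_pow,
    derivative_C, derivative_X, derivative_ofNat, derivative_one, eval_add, eval_sub, eval_neg, eval_mul,
    eval_pow, eval_C, eval_X, eval_ofNat, eval_natCast, eval_one, eval_zero, Nat.cast_ofNat]
  ring
theorem Dm_path_deriv (c₄ c₆ l m : R) :
    (derivative (Dm (C c₄) (C c₆) (1 - X + X * C l) (X * C m))).eval 0 = -132 * c₄ * m := by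
  simp only [Dm, derivative_add, derivative_sub, derivative_neg, derivative_mul, derivative_pow,
    derivative_C, derivative_X, derivative_ofNat, derivative_one, eval_add, eval_sub, eval_neg, eval_mul,
    eval_pow, eval_C, eval_X, eval_ofNat, eval_natCast, eval_one, eval_zero, Nat.cast_ofNat]
  ring
theorem Dll_path_deriv (c₄ c₆ l m : R) :
    (derivative (Dll (C c₄) (C c₆) (1 - X + X * C l) (X * C m))).eval 0 = 1320 * (l - 1) := by
  simp only [Dll, derivative_add, derivative_sub, derivative_neg, derivative_mul, derivative_pow,
    derivative_C, derivative_X, derivative_ofNat, derivative_one, eval_add, eval_sub, eval_neg, eval_mul,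
    eval_pow, eval_C, eval_X, eval_ofNat, eval_natCast, eval_one, eval_zero, Nat.cast_ofNat]
  ring
theorem Dlm_path_deriv (c₄ c₆ l m : R) :
    (derivative (Dlm (C c₄) (C c₆) (1 - X + X * C l) (X * C m))).eval 0 = -1320 * c₄ * m := by
  simp only [Dlm, derivative_add, derivative_sub, derivative_neg, derivative_mul, derivative_pow,
    derivative_C, derivative_X, derivative_ofNat, derivative_one, eval_add, eval_sub, eval_neg, eval_mul,
    eval_pow, eval_C, eval_X, eval_ofNat, eval_natCast, eval_one, eval_zero, Nat.cast_ofNat]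
  ring
theorem Dmm_path_deriv (c₄ c₆ l m : R) :
    (derivative (Dmm (C c₄) (C c₆) (1 - X + X * C l) (X * C m))).eval 0 =
      -1320 * c₄ * (l - 1) - 2640 * c₆ * m := by
  simp only [Dmm, derivative_add, derivative_sub, derivative_neg, derivative_mul, derivative_pow,
    derivative_C, derivative_X, derivative_ofNat, derivative_one, eval_add, eval_sub, eval_neg, eval_mul,
    eval_pow, eval_C, eval_X, eval_ofNat, eval_natCast, eval_one, eval_zero, Nat.cast_ofNat]
  ring
theorem Dlll_path_deriv (c₄ c₆ l m : R) :
    (derivative (Dlll (C c₄) (C c₆) (1 - X + X * C l) (X * C m))).eval 0 = 11880 * (l - 1) := by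
  simp only [Dlll, derivative_add, derivative_sub, derivative_neg, derivative_mul, derivative_pow,
    derivative_C, derivative_X, derivative_ofNat, derivative_one, eval_add, eval_sub, eval_neg, eval_mul,
    eval_pow, eval_C, eval_X, eval_ofNat, eval_natCast, eval_one, eval_zero, Nat.cast_ofNat]
  ring
theorem Dllm_path_deriv (c₄ c₆ l m : R) :
    (derivative (Dllm (C c₄) (C c₆) (1 - X + X * C l) (X * C m))).eval 0 = -11880 * c₄ * m := by
  simp only [Dllm, derivative_add, derivative_sub, derivative_neg, derivative_mul, derivative_pow,
    derivative_C, derivative_X, derivative_ofNat, derivative_one, eval_add, eval_sub, eval_neg, eval_mul,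
    eval_pow, eval_C, eval_X, eval_ofNat, eval_natCast, eval_one, eval_zero, Nat.cast_ofNat]
  ring
theorem Dlmm_path_deriv (c₄ c₆ l m : R) :
    (derivative (Dlmm (C c₄) (C c₆) (1 - X + X * C l) (X * C m))).eval 0 =
      -11880 * c₄ * (l - 1) - 23760 * c₆ * m := by
  simp only [Dlmm, derivative_add, derivative_sub, derivative_neg, derivative_mul, derivative_pow,
    derivative_C, derivative_X, derivative_ofNat, derivative_one, eval_add, eval_sub, eval_neg, eval_mul,
    eval_pow, eval_C, eval_X, eval_ofNat, eval_natCast, eval_one, eval_zero, Nat.cast_ofNat]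
  ring
theorem Dmmm_path_deriv (c₄ c₆ l m : R) :
    (derivative (Dmmm (C c₄) (C c₆) (1 - X + X * C l) (X * C m))).eval 0 =
      -35640 * c₄ ^ 2 * m - 23760 * c₆ * (l - 1) := by
  simp only [Dmmm, derivative_add, derivative_sub, derivative_neg, derivative_mul, derivative_pow,
    derivative_C, derivative_X, derivative_ofNat, derivative_one, eval_add, eval_sub, eval_neg, eval_mul,
    eval_pow, eval_C, eval_X, eval_ofNat, eval_natCast, eval_one, eval_zero, Nat.cast_ofNat]
  ring

/-- **`q'(0)` on Fisher's segment:** `(C6N(c₄, c₆, 1 − X + Xl, Xm))'(0) = 125452800·((l − 1)c₆ + m c₄²)`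
(`125452800 = 30 · 4181760`; product rule over the eighteen atoms above). -/
theorem C6N_path_deriv (c₄ c₆ l m : R) :
    (derivative (C6N (C c₄) (C c₆) (1 - X + X * C l) (X * C m))).eval 0 =
      125452800 * ((l - 1) * c₆ + m * c₄ ^ 2) := by
  simp only [C6N, derivative_mul, derivative_sub, derivative_add, derivative_neg, derivative_ofNat,
    eval_mul, eval_sub, eval_add, eval_neg, eval_ofNat, zero_mul, zero_add,
    Dl_path_eval, Dm_path_eval, Dll_path_eval, Dlm_path_eval, Dmm_path_eval, Dlll_path_eval,
    Dllm_path_eval, Dlmm_path_eval, Dmmm_path_eval, Dl_path_deriv, Dm_path_deriv, Dll_path_deriv,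
    Dlm_path_deriv, Dmm_path_deriv, Dlll_path_deriv, Dllm_path_deriv, Dlmm_path_deriv, Dmmm_path_deriv]
  ring

/-- **Scalings have `𝔠₆(λ, 0) = λ³⁰ c₆`:** `C6N(c₄, c₆, L, 0) = 4181760·c₆·L³⁰`. -/
theorem C6N_mu_zero (c₄ c₆ L : R) : C6N c₄ c₆ L 0 = 4181760 * c₆ * L ^ 30 := by
  simp only [C6N, Dl, Dm, Dll, Dlm, Dmm, Dlll, Dllm, Dlmm, Dmmm]
  ring

end Hesse

/-- **First-order sign rigidity (NEW, replaces g13 `sign_rigidity_anchor` at `j = 1728`).**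
`p = ±q`, `p(0) = q(0)`, `p'(0) = q'(0)`, and `q(0) ≠ 0 ∨ q'(0) ≠ 0 ∨ q = 0` force `p = q`
(characteristic `0`). -/
theorem sign_rigidity_taylor1 {L : Type*} [CommRing L] [IsDomain L] [CharZero L] (p q : L[X])
    (h : p = q ∨ p = -q) (h0 : p.eval 0 = q.eval 0)
    (h1 : (derivative p).eval 0 = (derivative q).eval 0)
    (hq : q.eval 0 ≠ 0 ∨ (derivative q).eval 0 ≠ 0 ∨ q = 0) : p = q := by
  rcases h with h | h
  · exact h
  · rcases hq with hq | hq | hq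
    · exfalso
      apply hq
      rw [h, eval_neg] at h0
      have h2 : (2 : L) * q.eval 0 = 0 := by linear_combination -h0
      exact (mul_eq_zero.mp h2).resolve_left two_ne_zero
    · exfalso
      apply hq
      rw [h, derivative_neg, eval_neg] at h1
      have h2 : (2 : L) * (derivative q).eval 0 = 0 := by linear_combination -h1
      exact (mul_eq_zero.mp h2).resolve_left two_ne_zero
    · rw [h, hq, neg_zero]

end Summit.ABC.ABC.Cruxes.FreyModularity.StubSwitchK3g15
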